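import Mathlib.RingTheory.Binomial
import Mathlib.Data.List.GetD
import Literature.Barriers.CriticalPhenomena.RigorousRGSmallParameterLocalMonomials
import HarnessLib

/-!
# `RigorousRGSmallParameter` (Slade, Theorem 1.4.1): the duality between local field monomials
# and binomial polynomial test functions — Lemma 2.1.2(i) of [BS-rg-loc], the core of the
# existence of the localisation operator `Loc`

Companion ("proof architecture") file of
`Literature/Barriers/CriticalPhenomena/RigorousRGSmallParameter.lean`, continuing
`…LocalMonomials` (the monomials `M_{m,a}` and the zero-field pairing formula (2.2) of
[BS-rg-loc] in slot-contraction form). The localisation operator `Loc_X` of [BS-rg-loc]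
(Definition 1.3.2; used by Slade §4.2 and by [BS-rg-step] to build the map of Slade's
Theorem 6.3.1) exists because the monomials `{M_{m,a}}_{m ∈ 𝔳_+}` and the polynomial test
functions `{f_m^{(a)}}_{m ∈ 𝔳_+}` are DUAL under the zero-field pairing: Lemma 2.1.2(i),
`⟨M_{m,a}, f^{(a)}_{m'}⟩_0 = δ_{m,m'}`, where `f_m^{(a)} = N_m S b_m^{(a)}` and
`b^{(a)}_{m,z} = ∏_k binom(z_k - a, α_k)` (display (2.3)) is the lattice-Taylor ("binomial") basis
of the polynomial test functions. This file PROVES that duality for the concrete model (one real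
boson species with `n` components on the torus `TorusSite d M`), in the following form:

* `⟨M_{m,a}, β_1 ⊗ ⋯ ⊗ β_p⟩_0 = (1/p!)·perm(r_{c_k}(β_j))` for every ordered product test function
  (`TphiPairing_monomial_tensorTF`, "the permanent formula" — the explicit content of (2.2) on
  product test functions), with the single contractions `r_{(i,α)}(β) = ∇^α β(·,i)(a)`;
* for the one-point binomials `b_{(i',α')}(x,i) = 𝟙{i=i'}∏_j binom(z_j(x), α'_j)` in the
  coordinate `z = coord a` of the patch around `a`, and forward multi-indices,
  `r_{(i,α)}(b_{(i',α')}) = 𝟙{i = i'}𝟙{α ≈ α'}` (`rowC_fwd_binomTF`: Pascal's rule for the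
  binomial polynomials `Ring.choose` and `binom(0,k) = 𝟙{k=0}`; no wrapping around the torus:
  `|α| ≤ M/2`);
* hence `⟨M_{m,a}, b_{m'}⟩_0 = pcount(m,m')/p!` with the pattern permanent `pcount` (number of
  bijections matching equivalent factors), which vanishes unless `m` and `m'` list equivalent
  factors up to order (`perm_of_pcount_ne_zero`) and is `≥ 1` on the diagonal
  (`one_le_pcount_self`), so that with `f_{m} := (p!/pcount(m,m))·b_m` (`dualTF`):
  **`⟨M_{m,a}, f_m⟩_0 = 1` and `⟨M_{m,a}, f_{m'}⟩_0 = 0` for inequivalent `m, m'`**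
  (`TphiPairing_monomial_dualTF_self`, `TphiPairing_monomial_dualTF_eq_zero`) — Lemma 2.1.2(i)
  for any family of pairwise inequivalent representatives `m ∈ 𝔳_+`.

Remark on faithfulness: [BS-rg-loc] take `f_m = N_m S b_m` with the symmetrisation `S` of
[BS-rg-norm]; since `⟨F, Sg⟩_0 = ⟨F, g⟩_0` for `F ∈ 𝒩` (the coefficients are symmetric,
`Tphi.coeff_perm`), pairings with elements of `𝒩` — all that `Loc` uses — are unchanged, and we
work with the ordered product `b_m` directly; `N_m = p!/pcount(m,m)` is their normalisation (2.5)
("chosen so that the case `m = m'` holds").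

Sources: D. C. Brydges, G. Slade, *A renormalisation group method. II. Approximation by local
polynomials*, J. Stat. Phys. 159 (2015) 461–491, arXiv:1403.7253, read from the TeX source: §1.3
(coordinates and coordinate patches; the monomial test functions `p_m(z) = ∏_k z_k^{α_k}`), §2.1 (displays (2.2)–(2.5),
Lemma 2.1.2(i)), §3.2 (its proof).

## What this file provides (definitions with proved properties; no named fact)

* `tensorTF` (ordered product test functions; `tensorTF_eq_zero_of_length`, `tensorTF_insertIdx`),
  `rowC` (single contraction), **`slotOp_tensorTF`** (`T_c(⊗β) = |β|⁻¹Σ_k r_c(β_k) ⊗(β∖β_k)`),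
  `lperm` (permanent by Laplace expansion), `TphiPairing_monomial_zero_congr`,
  **`TphiPairing_monomial_tensorTF`** (the permanent formula).
* `coord` (the coordinate of [BS-rg-loc] §1.3 around `a`, via `ZMod.valMinAbs`), `offsetPt`,
  `coord_offsetPt`, `binomTF` (one-point binomial test functions (2.3)), `fwd`, `cls`,
  **`fdiffs_multiBinom`** (forward differences of `∏_j binom(z_j,t_j)`), **`rowC_fwd_binomTF`**.
* `pcount` (pattern permanent) with `lperm_binomTF`, `pcount_nonneg`, `one_le_pcount_self`,
  `perm_of_pcount_ne_zero`; `dualTF` (`f_m^{(a)}`), **`TphiPairing_monomial_dualTF`**,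
  `TphiPairing_monomial_dualTF_self`, `TphiPairing_monomial_dualTF_eq_zero` (Lemma 2.1.2(i)).

## References

* [BrydgesSlade2015RGII] D. C. Brydges, G. Slade, *A renormalisation group method. II.
  Approximation by local polynomials*, J. Stat. Phys. 159 (2015) 461–491, arXiv:1403.7253 —
  §1.3, §2.1 (Lemma 2.1.2), §3.2.
* [BrydgesSlade2015RGI] D. C. Brydges, G. Slade, *A renormalisation group method. I.*,
  J. Stat. Phys. 159 (2015) 421–460, arXiv:1403.7244 — §3.4 (the symmetrisation `S`).
* [Slade2017] G. Slade, *Critical exponents for long-range O(n) models below the upper critical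
  dimension*, Commun. Math. Phys. 358 (2018) 343–436, arXiv:1611.06169 — §4.2 (Loc).
-/

noncomputable section

namespace Literature.Barriers.CriticalPhenomena

namespace LongRangePhi4

namespace Loc

open Finset Tphi RGNorm LocalPoly Literature.Probability.LatticeModels
open scoped ContDiff

variable {d M n : ℕ} [NeZero M]

/-! ### Ordered product test functions `β_1 ⊗ ⋯ ⊗ β_p` -/

/-- The ordered product test function `(β_1 ⊗ ⋯ ⊗ β_p)_z = ∏_k β_k(z_k)` on sequences of length
`p`, zero on other lengths (the monomial test functions `p_m(z) = ∏_k z_k^{α_k}` of §1.3 and the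
binomial test functions `b_m^{(a)}` (2.3) of [BS-rg-loc] are of this form). [cite: BrydgesSlade2015RGII, §1.3 (display defining p_m) and §2.1 (display (2.3))] -/
def tensorTF : List (TorusSite d M × Fin n → ℝ) → List (TorusSite d M × Fin n) → ℝ
  | [], [] => 1
  | β :: βs, y :: z => β y * tensorTF βs z
  | _, _ => 0

omit [NeZero M] in
/-- `⊗∅ = 𝟙_{∅}` on the empty sequence. [folklore] -/
@[simp] theorem tensorTF_nil_nil : tensorTF ([] : List (TorusSite d M × Fin n → ℝ)) [] = 1 := rfl

omit [NeZero M] in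
/-- `(β ⊗ B)_{y·z} = β(y) B_z`. [folklore] -/
@[simp] theorem tensorTF_cons_cons (β : TorusSite d M × Fin n → ℝ) (βs : List (TorusSite d M × Fin n → ℝ))
    (y : TorusSite d M × Fin n) (z : List (TorusSite d M × Fin n)) :
    tensorTF (β :: βs) (y :: z) = β y * tensorTF βs z := rfl

omit [NeZero M] in
/-- `⊗βs` vanishes off length `|βs|`. [folklore] -/
theorem tensorTF_eq_zero_of_length : ∀ (βs : List (TorusSite d M × Fin n → ℝ))
    (z : List (TorusSite d M × Fin n)), z.length ≠ βs.length → tensorTF βs z = 0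
  | [], [], h => absurd rfl h
  | [], _ :: _, _ => rfl
  | _ :: _, [], _ => rfl
  | β :: βs, y :: z, h => by
      rw [tensorTF_cons_cons, tensorTF_eq_zero_of_length βs z (by simpa using h), mul_zero]

omit [NeZero M] in
/-- Inserting a letter at slot `k` factors off the `k`-th factor:
`(⊗βs)_{v ⊲_k y} = β_k(y) (⊗(βs ∖ β_k))_v`. [folklore] -/
theorem tensorTF_insertIdx : ∀ (βs : List (TorusSite d M × Fin n → ℝ)) (k : ℕ)
    (v : List (TorusSite d M × Fin n)) (y : TorusSite d M × Fin n),
    k < βs.length → v.length + 1 = βs.length →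
    tensorTF βs (v.insertIdx k y) = βs.getD k 0 y * tensorTF (βs.eraseIdx k) v
  | [], _, _, _, h, _ => absurd h (Nat.not_lt_zero _)
  | β :: βs, 0, v, y, _, _ => by simp
  | β :: βs, k + 1, [], y, hk, hv => by simp at hv; simp [hv] at hk
  | β :: βs, k + 1, w :: v, y, hk, hv => by
      rw [List.insertIdx_succ_cons, tensorTF_cons_cons,
        tensorTF_insertIdx βs k v y (by simpa using hk) (by simpa using hv)]
      simp only [List.getD_cons_succ, List.eraseIdx_cons_succ, tensorTF_cons_cons]
      ring

/-- **The single contraction** `r_c(β) = ∇^α β(·, i)(a)` of a one-point test function with the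
factor `c = (i, α)` of a monomial at `a`. [folklore] -/
def rowC (a : TorusSite d M) (c : Fin n × List (Fin d × Bool)) (β : TorusSite d M × Fin n → ℝ) : ℝ :=
  fdiffs (c.2.map (unitStep d M)) (fun x => β (x, c.1)) a

omit [NeZero M] in
/-- **Slot contraction of a product test function**:
`T_c(⊗βs)_v = |βs|⁻¹ Σ_k r_c(β_k) (⊗(βs ∖ β_k))_v` on `|v| = |βs| - 1`, zero otherwise. [folklore] -/
theorem slotOp_tensorTF (a : TorusSite d M) (c : Fin n × List (Fin d × Bool))
    (βs : List (TorusSite d M × Fin n → ℝ)) :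
    slotOp a c (tensorTF βs) = fun v =>
      if v.length + 1 = βs.length then
        ((βs.length : ℕ) : ℝ)⁻¹ * ∑ k ∈ range βs.length, rowC a c (βs.getD k 0) * tensorTF (βs.eraseIdx k) v
      else 0 := by
  funext v
  unfold slotOp
  by_cases h : v.length + 1 = βs.length
  · rw [if_pos h, ← h]
    congr 1
    refine Finset.sum_congr rfl fun k hk => ?_
    rw [Finset.mem_range] at hk
    rw [napply_slot _ _ _ _ _ _ (by omega)]
    have hfun : (fun x => tensorTF βs (v.insertIdx k (x, c.1))) =
        fun x => tensorTF (βs.eraseIdx k) v * (fun x' => βs.getD k 0 (x', c.1)) x := by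
      funext x
      rw [tensorTF_insertIdx βs k v (x, c.1) (by omega) h, mul_comm]
    rw [hfun, fdiffs_const_mul, mul_comm]
    rfl
  · rw [if_neg h, Finset.sum_eq_zero, mul_zero]
    intro k hk
    rw [Finset.mem_range] at hk
    refine napply_eq_zero_of_length _ _ _ _ fun w hw => tensorTF_eq_zero_of_length βs w ?_
    rw [hw, List.length_insertIdx_of_le_length (by omega)]
    exact h

/-! ### The permanent formula for `⟨M_{m,a}, β_1 ⊗ ⋯ ⊗ β_p⟩_0` -/

/-- The permanent of the matrix `(r_k(β_j))_{k,j}` of a list of functionals against a list of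
vectors, by Laplace expansion along the first row: `perm(r·rs, βs) = Σ_j r(β_j) perm(rs, βs ∖ β_j)`.
[folklore] -/
def lperm : List ((TorusSite d M × Fin n → ℝ) → ℝ) → List (TorusSite d M × Fin n → ℝ) → ℝ
  | [], [] => 1
  | [], _ :: _ => 0
  | r :: rs, βs => ∑ k ∈ range βs.length, r (βs.getD k 0) * lperm rs (βs.eraseIdx k)

omit [NeZero M] in
/-- `perm(∅, ∅) = 1`. [folklore] -/
@[simp] theorem lperm_nil_nil : lperm ([] : List ((TorusSite d M × Fin n → ℝ) → ℝ)) [] = 1 := rfl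

omit [NeZero M] in
/-- Laplace expansion along the first row. [folklore] -/
theorem lperm_cons (r : (TorusSite d M × Fin n → ℝ) → ℝ) (rs : List ((TorusSite d M × Fin n → ℝ) → ℝ))
    (βs : List (TorusSite d M × Fin n → ℝ)) :
    lperm (r :: rs) βs = ∑ k ∈ range βs.length, r (βs.getD k 0) * lperm rs (βs.eraseIdx k) := rfl

/-- The pairing with `M_{m,a}` at zero field reads a test function only in degree `p(m)`. [folklore] -/
theorem TphiPairing_monomial_zero_congr (pN : ℕ) (m : List (Fin n × List (Fin d × Bool))) (a : TorusSite d M)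
    {g g' : List (TorusSite d M × Fin n) → ℝ} (h : ∀ v, v.length = m.length → g v = g' v) :
    TphiPairing pN (basisDir d M n) (monomial m a) 0 g = TphiPairing pN (basisDir d M n) (monomial m a) 0 g' := by
  unfold TphiPairing pairing
  refine Finset.sum_congr rfl fun r _ => ?_
  congr 1
  refine sumSeq_congr r fun z hz => ?_
  by_cases hr : r = m.length
  · rw [h z (hz.trans hr)]
  · rw [coeffFamily_monomial_zero_eq_zero m a z (hz ▸ hr), zero_mul, zero_mul]

/-- **The permanent formula**: for a monomial of degree `p` and a product test function of rank
`p`, `⟨M_{m,a}, β_1 ⊗ ⋯ ⊗ β_p⟩_0 = (1/p!) perm(r_{c_k}(β_j))_{k,j}` — the explicit content of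
`⟨M_{m,a}, g⟩_0 = ∇^m(Sg)_{a⃗}` ([BS-rg-loc] (2.2)) on product test functions: the sum over
permutations `σ` of `∏_k ∇^{α_k}β_{σk}(·, i_k)(a)`. [cite: BrydgesSlade2015RGII, §2.1 (display (2.2))] -/
theorem TphiPairing_monomial_tensorTF {pN : ℕ} (hpN : 1 ≤ pN) (a : TorusSite d M) :
    ∀ (m : List (Fin n × List (Fin d × Bool))) (βs : List (TorusSite d M × Fin n → ℝ)),
    m.length = βs.length → βs.length ≤ pN →
    TphiPairing pN (basisDir d M n) (monomial m a) 0 (tensorTF βs) =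
      ((βs.length.factorial : ℕ) : ℝ)⁻¹ * lperm (m.map (rowC a)) βs
  | [], [], _, _ => by rw [TphiPairing_monomial_nil]; simp
  | [], _ :: _, h, _ => by simp at h
  | _ :: _, [], h, _ => by simp at h
  | c :: m, β :: βs, hlen, hp => by
      have hg : ∀ z : List (TorusSite d M × Fin n), pN < z.length → tensorTF (β :: βs) z = 0 :=
        fun z hz => tensorTF_eq_zero_of_length _ z (by simp only [List.length_cons] at hp ⊢; omega)
      rw [TphiPairing_monomial_cons_zero hpN c m a hg, slotOp_tensorTF]
      rw [TphiPairing_monomial_zero_congr pN m a (g' := fun v => (((β :: βs).length : ℕ) : ℝ)⁻¹ *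
          ∑ k ∈ range (β :: βs).length, rowC a c ((β :: βs).getD k 0) * tensorTF ((β :: βs).eraseIdx k) v)]
      swap
      · intro v hv
        rw [if_pos (by simp at hlen ⊢; omega)]
      unfold TphiPairing
      rw [pairing_smul_right, pairing_sum_right]
      simp only [pairing_smul_right]
      rw [List.map_cons, lperm_cons, Finset.mul_sum, Finset.mul_sum]
      refine Finset.sum_congr rfl fun k hk => ?_
      rw [Finset.mem_range] at hk
      have hlen' : m.length = ((β :: βs).eraseIdx k).length := by
        rw [List.length_eraseIdx_of_lt hk]; simp at hlen ⊢; omega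
      have ih := TphiPairing_monomial_tensorTF hpN a m ((β :: βs).eraseIdx k) hlen'
        (by rw [← hlen']; simp only [List.length_cons] at hlen hp; omega)
      unfold TphiPairing at ih
      rw [ih, ← hlen']
      simp only [List.length_cons] at hlen ⊢
      have hlen2 : m.length = βs.length := by omega
      rw [hlen2, Nat.factorial_succ]
      push_cast
      have h0 : ((βs.length.factorial : ℕ) : ℝ) ≠ 0 := by positivity
      field_simp

/-! ### Coordinates around a point and the binomial test functions `b_m^{(a)}` -/

/-- The coordinate `z = (x_1,…,x_d)` of [BS-rg-loc] §1.3 on the patch around `a`: the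
representative of minimal absolute value of `y - a` in each direction. [cite: BrydgesSlade2015RGII, §1.3 ("a map z = (x_1,…,x_d) from Λ'^{(1)} to ℤ^d is said to be a coordinate")] -/
def coord (a y : TorusSite d M) (j : Fin d) : ℤ := (y j - a j).valMinAbs

/-- **The binomial test functions** `b^{(a)}`: for a component `i'` and a forward multi-index `α'`
(a list of directions), the one-point function `y = (x, i) ↦ 𝟙{i = i'} ∏_j binom(z_j(x), α'_j)`
with `z = coord a` ("the monomial `z_k^{α_k}` replaced by the polynomial `binom(z_k - a, α_k)`",
[BS-rg-loc] (2.3)); the rank-`p` test function `b_m^{(a)}` is their ordered product `tensorTF`.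
[cite: BrydgesSlade2015RGII, §2.1 (display (2.3))] -/
def binomTF (a : TorusSite d M) (c' : Fin n × List (Fin d)) : TorusSite d M × Fin n → ℝ :=
  fun y => if y.2 = c'.1 then ∏ j : Fin d, ((Ring.choose (coord a y.1 j) (c'.2.count j) : ℤ) : ℝ) else 0

/-- A forward multi-index as a list of unit steps `+e_j`. [folklore] -/
def fwd (c : Fin n × List (Fin d)) : Fin n × List (Fin d × Bool) := (c.1, c.2.map fun j => (j, true))

/-- The point `a + v` for an offset `v ∈ ℕ^d`. [folklore] -/
def offsetPt (a : TorusSite d M) (v : Fin d → ℕ) : TorusSite d M := fun j => a j + (v j : ZMod M)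

omit [NeZero M] in
/-- `a + 0 = a`. [folklore] -/
@[simp] theorem offsetPt_zero (a : TorusSite d M) : offsetPt a (fun _ => 0) = a := by
  funext j; simp [offsetPt]

omit [NeZero M] in
/-- `(a + v) + e_j = a + (v + δ_j)`. [folklore] -/
theorem offsetPt_add_unitStep (a : TorusSite d M) (v : Fin d → ℕ) (j : Fin d) :
    offsetPt a v + unitStep d M (j, true) = offsetPt a (v + Pi.single j 1) := by
  funext j'
  simp only [offsetPt, unitStep, Pi.add_apply, if_true]
  by_cases h : j' = j
  · subst h; simp; ring
  · simp [h]

omit [NeZero M] in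
/-- Inside the patch the coordinate of `a + v` is `v`: `z_j(a + v) = v_j` when `v_j ≤ M/2`. [folklore] -/
theorem coord_offsetPt (a : TorusSite d M) {v : Fin d → ℕ} {j : Fin d} (hv : v j ≤ M / 2) :
    coord a (offsetPt a v) j = v j := by
  simp only [coord, offsetPt, add_sub_cancel_left]
  exact ZMod.valMinAbs_natCast_of_le_half hv

omit [NeZero M] in
/-- **Forward differences of the multi-binomial**: for `t ∈ ℕ^d` and a forward multi-index `α`,
`∇^α ∏_j binom(z_j, t_j)` at `a + v` is `∏_j binom(v_j, t_j - α_j)` if `α ≤ t` and `0`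
otherwise (Pascal's rule `binom(r+1,s) - binom(r,s) = binom(r,s-1)`), inside the patch. [folklore] -/
theorem fdiffs_multiBinom (a : TorusSite d M) (t : Fin d → ℕ) :
    ∀ (α : List (Fin d)) (v : Fin d → ℕ), (∀ j, v j + α.length ≤ M / 2) →
    fdiffs ((α.map fun j => (j, true)).map (unitStep d M))
        (fun x => ∏ j : Fin d, ((Ring.choose (coord a x j) (t j) : ℤ) : ℝ)) (offsetPt a v) =
      if ∀ j, α.count j ≤ t j then ∏ j : Fin d, ((Ring.choose (v j : ℤ) (t j - α.count j) : ℤ) : ℝ)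
      else 0
  | [], v, hv => by
      simp only [List.map_nil, fdiffs_nil, List.count_nil, zero_le, implies_true, if_true, Nat.sub_zero]
      refine Finset.prod_congr rfl fun j _ => ?_
      rw [coord_offsetPt a (by have := hv j; simpa using this)]
  | j₀ :: α, v, hv => by
      rw [List.map_cons, List.map_cons, fdiffs_cons]
      simp only []
      rw [offsetPt_add_unitStep,
        fdiffs_multiBinom a t α (v + Pi.single j₀ 1) (fun j => by
          have := hv j; simp only [Pi.add_apply, List.length_cons] at this ⊢
          by_cases h : j = j₀
          · subst h; simp; omega
          · simp [h]; omega),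
        fdiffs_multiBinom a t α v (fun j => by have := hv j; simp at this; omega)]
      by_cases hcond : ∀ j, α.count j ≤ t j
      · rw [if_pos hcond, if_pos hcond]
        -- split off the factor `j₀`
        rw [← Finset.mul_prod_erase _ _ (Finset.mem_univ j₀), ← Finset.mul_prod_erase _ _ (Finset.mem_univ j₀)]
        have hrest : ∏ j ∈ Finset.univ.erase j₀, ((Ring.choose (((v + Pi.single j₀ 1 : Fin d → ℕ) j : ℕ) : ℤ) (t j - α.count j) : ℤ) : ℝ) =
            ∏ j ∈ Finset.univ.erase j₀, ((Ring.choose ((v j : ℕ) : ℤ) (t j - α.count j) : ℤ) : ℝ) := by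
          refine Finset.prod_congr rfl fun j hj => ?_
          rw [Finset.mem_erase] at hj
          simp [hj.1]
        rw [hrest, ← sub_mul]
        have hj0 : ((v + Pi.single j₀ 1 : Fin d → ℕ) j₀ : ℕ) = v j₀ + 1 := by simp
        rw [hj0]
        by_cases hs : α.count j₀ + 1 ≤ t j₀
        · have hcond' : ∀ j, (j₀ :: α).count j ≤ t j := by
            intro j
            by_cases h : j = j₀
            · subst h; rw [List.count_cons_self]; exact hs
            · rw [List.count_cons, beq_false_of_ne (Ne.symm h)]; simpa using hcond j
          rw [if_pos hcond', ← Finset.mul_prod_erase _ _ (Finset.mem_univ j₀)]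
          have hrest' : ∏ j ∈ Finset.univ.erase j₀, ((Ring.choose ((v j : ℕ) : ℤ) (t j - (j₀ :: α).count j) : ℤ) : ℝ) =
              ∏ j ∈ Finset.univ.erase j₀, ((Ring.choose ((v j : ℕ) : ℤ) (t j - α.count j) : ℤ) : ℝ) := by
            refine Finset.prod_congr rfl fun j hj => ?_
            rw [Finset.mem_erase] at hj
            rw [List.count_cons, beq_false_of_ne (Ne.symm hj.1)]
            simp
          rw [hrest', List.count_cons_self]
          congr 1
          -- Pascal's rule
          obtain ⟨s', hs'⟩ : ∃ s', t j₀ - α.count j₀ = s' + 1 := ⟨t j₀ - α.count j₀ - 1, by omega⟩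
          rw [hs', show t j₀ - (α.count j₀ + 1) = s' by omega]
          push_cast
          rw [Ring.choose_succ_succ]
          push_cast
          ring
        · have ht : t j₀ - α.count j₀ = 0 := by have := hcond j₀; omega
          have hcond' : ¬ ∀ j, (j₀ :: α).count j ≤ t j := fun h => hs (by
            have := h j₀; rwa [List.count_cons_self] at this)
          rw [if_neg hcond', ht]
          simp
      · have hcond' : ¬ ∀ j, (j₀ :: α).count j ≤ t j := fun h => hcond fun j =>
          List.count_le_count_cons.trans (h j)
        rw [if_neg hcond, if_neg hcond, if_neg hcond', sub_zero]

omit [NeZero M] in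
/-- `∇^l 0 = 0`. [folklore] -/
theorem fdiffs_zero : ∀ l : List (TorusSite d M), fdiffs l (fun _ => (0 : ℝ)) = fun _ => 0
  | [] => rfl
  | s :: l => by funext x; simp [fdiffs_cons, fdiffs_zero l]

/-- The class of a forward index `(i, α)`: the component and the multi-index as a multiset (the
monomial depends on `α` only through the multiset, `dfield_perm`). [folklore] -/
def cls (c : Fin n × List (Fin d)) : Fin n × Multiset (Fin d) := (c.1, (c.2 : Multiset (Fin d)))

omit [NeZero M] in
/-- Equal classes means equal components and permutation-equivalent multi-indices. [folklore] -/
theorem cls_eq_cls_iff (c c' : Fin n × List (Fin d)) : cls c = cls c' ↔ c.1 = c'.1 ∧ c.2.Perm c'.2 := by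
  simp [cls, Prod.ext_iff, Multiset.coe_eq_coe]

omit [NeZero M] in
/-- **The single contractions of the binomial test functions are the Kronecker delta on classes**:
`∇^α b_{(i',α')}(·, i)(a) = 𝟙{i = i'} 𝟙{α ≈ α'}` for forward multi-indices (no wrapping:
`|α| ≤ M/2`) — the computation behind `⟨M_{m,a}, f^{(a)}_{m'}⟩_0 = δ_{m,m'}`, Lemma 2.1.2(i) of
[BS-rg-loc]. [cite: BrydgesSlade2015RGII, Lemma 2.1.2(i) (proof in §3.2)] -/
theorem rowC_fwd_binomTF (a : TorusSite d M) (c c' : Fin n × List (Fin d)) (hM : c.2.length ≤ M / 2) :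
    rowC a (fwd c) (binomTF a c') = if cls c = cls c' then 1 else 0 := by
  unfold rowC fwd binomTF
  simp only []
  by_cases hi : c.1 = c'.1
  · simp only [hi, if_true]
    have h := fdiffs_multiBinom a (fun j => c'.2.count j) c.2 (fun _ => 0) (fun j => by simpa using hM)
    rw [offsetPt_zero] at h
    rw [h]
    by_cases hc : cls c = cls c'
    · rw [if_pos hc]
      have hperm : c.2.Perm c'.2 := ((cls_eq_cls_iff c c').1 hc).2
      have hcount : ∀ j, c.2.count j = c'.2.count j := fun j => hperm.count_eq j
      rw [if_pos (fun j => (hcount j).le)]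
      refine Finset.prod_eq_one fun j _ => ?_
      rw [hcount j, Nat.sub_self]
      simp
    · rw [if_neg hc]
      have hnp : ¬ c.2.Perm c'.2 := fun h' => hc ((cls_eq_cls_iff c c').2 ⟨hi, h'⟩)
      rw [List.perm_iff_count] at hnp
      simp only [not_forall] at hnp
      obtain ⟨j, hj⟩ := hnp
      by_cases hcond : ∀ j, c.2.count j ≤ c'.2.count j
      · rw [if_pos hcond]
        refine Finset.prod_eq_zero (Finset.mem_univ j) ?_
        have hlt : 0 < c'.2.count j - c.2.count j := by have := hcond j; omega
        obtain ⟨k, hk⟩ : ∃ k, c'.2.count j - c.2.count j = k + 1 := ⟨_, (Nat.succ_pred_eq_of_pos hlt).symm⟩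
        rw [hk]
        simp [Ring.choose_zero_succ]
      · rw [if_neg hcond]
  · have hfun : (fun x : TorusSite d M => if c.1 = c'.1 then
        ∏ j : Fin d, ((Ring.choose (coord a x j) (c'.2.count j) : ℤ) : ℝ) else 0) = fun _ => 0 := by
      funext x; rw [if_neg hi]
    rw [hfun, fdiffs_zero]
    have hc : cls c ≠ cls c' := fun h => hi ((cls_eq_cls_iff c c').1 h).1
    rw [if_neg hc]

/-! ### The pattern permanent and the duality (Lemma 2.1.2(i)) for class representatives -/

/-- The permanent of the `0/1` class-pattern matrix `(𝟙{cls c_k = cls c'_j})_{k,j}`: the number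
of bijections matching the factors of `m` with equivalent factors of `m'`. [folklore] -/
def pcount : List (Fin n × List (Fin d)) → List (Fin n × List (Fin d)) → ℝ
  | [], [] => 1
  | [], _ :: _ => 0
  | c :: m, m' => ∑ k ∈ range m'.length, (if cls c = cls (m'.getD k c) then 1 else 0) * pcount m (m'.eraseIdx k)

omit [NeZero M] in
/-- `pcount ∅ ∅ = 1`. [folklore] -/
@[simp] theorem pcount_nil_nil : pcount ([] : List (Fin n × List (Fin d))) [] = 1 := rfl

omit [NeZero M] in
/-- Laplace expansion of the pattern permanent. [folklore] -/
theorem pcount_cons (c : Fin n × List (Fin d)) (m m' : List (Fin n × List (Fin d))) :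
    pcount (c :: m) m' =
      ∑ k ∈ range m'.length, (if cls c = cls (m'.getD k c) then 1 else 0) * pcount m (m'.eraseIdx k) := rfl

omit [NeZero M] in
/-- **The permanent of single contractions of binomial test functions is the pattern permanent.** [folklore] -/
theorem lperm_binomTF (a : TorusSite d M) : ∀ (m m' : List (Fin n × List (Fin d))),
    (∀ c ∈ m, c.2.length ≤ M / 2) →
    lperm ((m.map fwd).map (rowC a)) (m'.map (binomTF a)) = pcount m m'
  | [], [], _ => rfl
  | [], _ :: _, _ => rfl
  | c :: m, m', hm => by
      rw [List.map_cons, List.map_cons, lperm_cons, pcount_cons, List.length_map]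
      refine Finset.sum_congr rfl fun k hk => ?_
      rw [Finset.mem_range] at hk
      rw [List.eraseIdx_map, lperm_binomTF a m (m'.eraseIdx k) (fun c' hc' => hm c' (List.mem_cons_of_mem c hc')),
        List.getD_eq_getElem _ _ (by simpa using hk), List.getElem_map,
        ← List.getD_eq_getElem m' c hk,
        rowC_fwd_binomTF a c _ (hm c List.mem_cons_self)]

omit [NeZero M] in
/-- The pattern permanent is nonnegative. [folklore] -/
theorem pcount_nonneg : ∀ m m' : List (Fin n × List (Fin d)), 0 ≤ pcount m m'
  | [], [] => zero_le_one
  | [], _ :: _ => le_rfl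
  | c :: m, m' => by
      rw [pcount_cons]
      exact Finset.sum_nonneg fun k _ => mul_nonneg (by split_ifs <;> norm_num) (pcount_nonneg m _)

omit [NeZero M] in
/-- The diagonal of the pattern permanent is `≥ 1` (the normalisation `N_m` of [BS-rg-loc] (2.5)
is well defined). [cite: BrydgesSlade2015RGII, §2.1 (display (2.5), "N_m is a normalisation constant")] -/
theorem one_le_pcount_self : ∀ m : List (Fin n × List (Fin d)), 1 ≤ pcount m m
  | [] => le_rfl
  | c :: m => by
      rw [pcount_cons, List.length_cons, Finset.sum_range_succ']
      simp only [List.getD_cons_zero, if_true, one_mul, List.eraseIdx_cons_zero]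
      refine le_add_of_nonneg_of_le (Finset.sum_nonneg fun k _ => ?_) (one_le_pcount_self m)
      exact mul_nonneg (by split_ifs <;> norm_num) (pcount_nonneg m _)

omit [NeZero M] in
/-- **A nonzero pattern permanent forces the index sequences to have the same classes up to
order** ("every non-zero monomial is represented by exactly one `m ∈ 𝔪`"). [cite: BrydgesSlade2015RGII, §1.2 (definition of 𝔪) and Lemma 2.1.2(i)] -/
theorem perm_of_pcount_ne_zero : ∀ m m' : List (Fin n × List (Fin d)), pcount m m' ≠ 0 →
    (m.map cls).Perm (m'.map cls)
  | [], [], _ => List.Perm.refl _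
  | [], _ :: _, h => absurd rfl h
  | c :: m, m', h => by
      rw [pcount_cons] at h
      obtain ⟨k, hk, hne⟩ := Finset.exists_ne_zero_of_sum_ne_zero h
      rw [Finset.mem_range] at hk
      have h1 : cls c = cls (m'.getD k c) := by
        by_contra h'
        rw [if_neg h', zero_mul] at hne
        exact hne rfl
      have h2 : pcount m (m'.eraseIdx k) ≠ 0 := fun h' => hne (by rw [h', mul_zero])
      have ih := perm_of_pcount_ne_zero m (m'.eraseIdx k) h2
      have hperm : (m'.getD k c :: m'.eraseIdx k).Perm m' := by
        rw [List.getD_eq_getElem m' c hk]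
        exact List.getElem_cons_eraseIdx_perm hk
      have h3 : ((c :: m).map cls).Perm ((m'.getD k c :: m'.eraseIdx k).map cls) := by
        rw [List.map_cons, List.map_cons, h1]
        exact List.Perm.cons _ ih
      exact h3.trans (hperm.map cls)

/-- **The dual test functions** `f^{(a)}_{m}` of the binomial basis: `f_m = (p!/N_m) b_m^{(a)}`
with `N_m = pcount m m` (our `b_m` is the ordered product of one-point binomials; [BS-rg-loc]
symmetrise it with `S`, which does not change pairings with elements of `𝒩`, `coeff_perm`).
[cite: BrydgesSlade2015RGII, §2.1 (displays (2.3), (2.5))] -/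
def dualTF (a : TorusSite d M) (m' : List (Fin n × List (Fin d))) : List (TorusSite d M × Fin n) → ℝ :=
  fun z => ((m'.length.factorial : ℕ) : ℝ) / pcount m' m' * tensorTF (m'.map (binomTF a)) z

/-- **The zero-field pairings of monomials with dual test functions**:
`⟨M_{m,a}, f_{m'}^{(a)}⟩_0 = pcount(m,m')/pcount(m',m')` in equal degree, `0` otherwise. [cite: BrydgesSlade2015RGII, Lemma 2.1.2(i)] -/
theorem TphiPairing_monomial_dualTF {pN : ℕ} (hpN : 1 ≤ pN) (a : TorusSite d M)
    (m m' : List (Fin n × List (Fin d))) (hm : ∀ c ∈ m, c.2.length ≤ M / 2) (hp : m'.length ≤ pN) :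
    TphiPairing pN (basisDir d M n) (monomial (m.map fwd) a) 0 (dualTF a m') =
      if m.length = m'.length then pcount m m' / pcount m' m' else 0 := by
  unfold dualTF
  unfold TphiPairing
  rw [pairing_smul_right]
  by_cases hlen : m.length = m'.length
  · rw [if_pos hlen]
    have h := TphiPairing_monomial_tensorTF hpN a (m.map fwd) (m'.map (binomTF a)) (by simpa using hlen)
      (by simpa using hp)
    unfold TphiPairing at h
    rw [h, lperm_binomTF a m m' hm, List.length_map, ← hlen]
    have h0 : ((m.length.factorial : ℕ) : ℝ) ≠ 0 := by positivity
    field_simp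
  · rw [if_neg hlen]
    have h := TphiPairing_monomial_zero_congr pN (m.map fwd) a (g := tensorTF (m'.map (binomTF a)))
      (g' := fun _ => 0) (fun v hv => tensorTF_eq_zero_of_length _ v (by simp at hv ⊢; omega))
    unfold TphiPairing at h
    rw [h, pairing_zero_right, mul_zero]

/-- **Lemma 2.1.2(i) of [BS-rg-loc], diagonal**: `⟨M_{m,a}, f_m^{(a)}⟩_0 = 1`. [cite: BrydgesSlade2015RGII, Lemma 2.1.2(i)] -/
theorem TphiPairing_monomial_dualTF_self {pN : ℕ} (hpN : 1 ≤ pN) (a : TorusSite d M)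
    (m : List (Fin n × List (Fin d))) (hm : ∀ c ∈ m, c.2.length ≤ M / 2) (hp : m.length ≤ pN) :
    TphiPairing pN (basisDir d M n) (monomial (m.map fwd) a) 0 (dualTF a m) = 1 := by
  rw [TphiPairing_monomial_dualTF hpN a m m hm hp, if_pos rfl,
    div_self (by have := one_le_pcount_self m; positivity)]

/-- **Lemma 2.1.2(i) of [BS-rg-loc], off-diagonal**: `⟨M_{m,a}, f_{m'}^{(a)}⟩_0 = 0` when `m` and
`m'` are not rearrangements of equivalent factors (distinct elements of `𝔪_+`). [cite: BrydgesSlade2015RGII, Lemma 2.1.2(i)] -/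
theorem TphiPairing_monomial_dualTF_eq_zero {pN : ℕ} (hpN : 1 ≤ pN) (a : TorusSite d M)
    (m m' : List (Fin n × List (Fin d))) (hm : ∀ c ∈ m, c.2.length ≤ M / 2) (hp : m'.length ≤ pN)
    (h : ¬ (m.map cls).Perm (m'.map cls)) :
    TphiPairing pN (basisDir d M n) (monomial (m.map fwd) a) 0 (dualTF a m') = 0 := by
  rw [TphiPairing_monomial_dualTF hpN a m m' hm hp]
  split_ifs with hlen
  · have h0 : pcount m m' = 0 := by
      by_contra h0
      exact h (perm_of_pcount_ne_zero m m' h0)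
    rw [h0, zero_div]
  · rfl

end Loc

end LongRangePhi4

end Literature.Barriers.CriticalPhenomena

end
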